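import Literature.NumberTheory.LFunctions.SekatskiiLiLaguerreForm
import Literature.NumberTheory.LFunctions.SekatskiiLiSumsAsymptotic
import HarnessLib

/-!
# Sekatskii's ζ-part of the generalized Li derivatives: decomposition (7a), Lemma 2, Proposition 1, eq. (21)

LABEL (line 1): **RH-FREE** identities and bounds (eq. (7a): the generalized Li derivative
`(1/(n−1)!) dⁿ/dzⁿ[(z+b)^{n−1} ln ξ(z)]|_{z=b+1}` = explicit trivial-zero / Gamma part + the "ζ-part"
`(1/(n−1)!) dⁿ/dzⁿ[(z+b)^{n−1} ln((z−1)ζ(z))]|_{z=b+1}`; Lemma 2 in an honest two-sided `O(n)` form),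
ONE **RH-EQUIVALENT** criterion (Proposition 1: an eventual one-sided lower bound
`ζ-part ≥ −(1−ε)(n/2) ln n` implies RH — PROVED, together with its converse under RH, so that the
condition IS RH), and ONE **RH-CONDITIONAL** corollary (eq. (21) in the weak form "on RH the ζ-part is
`O(n)`").  S. K. Sekatskii, arXiv:1404.7276v2, §§2–4 [Sekatskii2015FirstApplications].  bears_on:
LADDER-RH L-C/L-P (COLUMN 4, LI; the `a`-family row).  WHAT THIS IS NOT (author's words, p. 18:
"(not very interesting) sufficient criterion"): the hypothesis of Proposition 1 is a one-sided bound
on an oscillating prime-power sum of RH strength; RH ⟺ that bound; nothing here bears on the truth of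
RH.

Source.  S. K. Sekatskii, *First applications of generalized Li's criterion to study the Riemann
zeta-function zeroes location*, arXiv:1404.7276v2 (2015) [Sekatskii2015FirstApplications]
(published: Springer PROMS **358** (2021) 241–254, not held, `acq-11710`), decoded from the arXiv PDF
as described in the sibling `SekatskiiLiLaguerreForm.lean`.  Verbatim (up to layout):

* **eq. (7a)** (p. 18): `(1/(n−1)!) dⁿ/dzⁿ((z+b)^{n−1} ln(ξ(z)))|_{z=b+1} =
  −(1/(2b+1)) Σ_{k=1}^{∞} (1 − ((2k−b)/(2k+b+1))ⁿ − n(2b+1)/(2k+b+1)) + (n/2)ψ((b+1)/2) + n/(b+1)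
  − (n/2) ln π + (1/(n−1)!) dⁿ/dzⁿ((z+b)^{n−1} ln((z−1)ς(z)))|_{z=b+1}` ("To avoid this situation,
  let us consider the term … where the expression to be differentiated does not contain neither a
  pole nor a zero at `z=1`. We have a slight modification of eq. (7)").
* **Lemma 2** (p. 10, eq. (11)): "For any fixed `b ≥ 0` we have in the limit of large `n`:
  `((2b+1)/2)(n ln n + (γ−1)n + n ln(2 − 5/(2b+3)) + O(1)) ≤ Σ_{k=1}^{∞} ((1 − (2b+1)/(2k+b+1))ⁿ − 1
  + n(2b+1)/(2k+b+1)) ≤ ((2b+1)/2)(n ln n + (γ−1)n + n ln(2 − 1/(b+1)) + O(1))`."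
* **Proposition 1** (p. 18): "Riemann hypothesis holds true if for some real `ε > 0` asymptotically
  we have `(1/(n−1)!) dⁿ/dzⁿ((z+b)^{n−1} ln((z−1)ς(z)))|_{z=b+1} ≥ −(1−ε)(n/2) ln n`."
* **eq. (21)** (p. 19, assuming RH): `(1/(n−1)!) dⁿ/dzⁿ((z+b)^{n−1} ln((z−1)ς(z)))|_{z=b+1}
  = (n/2) ln(b+½) − A_n − (n/2)ψ((b+1)/2) − n/(b+1) + o(n)`, `(n/2) ln(2 − 5/(2b+3)) < A_n <
  (n/2) ln(2 − 1/(b+1))`; followed by: "We suspect, but cannot prove, that an exact compensation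
  indeed occurs and `… = o(n)` for all `b > 0`."

## Dictionary (paper ↦ tree)

* `(1/(n−1)!) dⁿ/dzⁿ[(z+b)^{n−1} ln ξ(z)]|_{z=b+1}` = `liSekatskiiDeriv (−b) (b+1) n`
  (`SekatskiiGeneralizedLiCriterion.lean`); by [Sekatskii2014] eq. (6) (`Sekatskii2014_sum_eq_deriv_holds`)
  `k_{n,−b} = (2b+1) · liSekatskiiDeriv (−b) (b+1) n`.
* the ζ-part `(1/(n−1)!) dⁿ/dzⁿ[(z+b)^{n−1} ln((z−1)ζ(z))]|_{z=b+1}` ↦ `liSekatskiiZetaDeriv (−b) (b+1) n`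
  (NEW definition, typed exactly like `liSekatskiiDeriv` with `ζ₁(z) = (z−1)ζ(z)` = the tree's
  `riemannZeta₁` in place of `ξ`; principal `Complex.log`, holomorphic near the real point where
  `ζ₁ > 0`; real part taken).
* the trivial-zero sum `S_b(n) = Σ_{k≥1}[(1 − (2b+1)/(2k+b+1))ⁿ − 1 + n(2b+1)/(2k+b+1)]` of (7a)/(11)
  ↦ `liSekatskiiTrivialZeroSum b n` (NEW definition; `1 − (2b+1)/(2k+b+1) = (2k−b)/(2k+b+1)`).

## Contents (source item ↦ declaration)

* defs `liSekatskiiZetaDeriv`, `liSekatskiiTrivialZeroSum`.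
* **eq. (7a)** `sekatskii2015_eq7a` — PROVED (`b > 0`, `n ≥ 1`), RH-FREE: Leibniz for both
  derivatives (sibling file), `ξ′/ξ − ζ₁′/ζ₁ = 1/z − ½ln π + ½ψ(z/2)` on `Re z > 1`, the polygamma
  series `(½ψ(·/2))^{(j)}(p) = (−1)^{j+1} j! Σ_{m≥0}(p+2m)^{−j−1}` (tree), and the binomial theorem
  summed over the Gamma poles `m ≥ 0` (the `m = 0` term cancels the `ln z` contribution exactly).
* **Lemma 2, honest form** `Sekatskii2015ZetaPart.trivialZeroSum_lower` / `trivialZeroSum_upper` /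
  `sekatskii2015_lemma2_isBigO`: `S_b(n) = ((2b+1)/2) n ln n + O_b(n)` — PROVED (RH-FREE, elementary:
  `0 ≤ (1−x)ⁿ − 1 + nx ≤ n²x²` on `[0,2]`, `≥ nx − 2`, and `Σ_{k≤n} 1/(k+c) = ln n + O(1)`).
  TYPING NOTE: the printed two-sided `O(1)`-precision constants `ln(2 − 5/(2b+3))`, `ln(2 − 1/(b+1))`
  of (11) are NOT vendored: the printed proof's integral comparison uses the monotonicity of
  `k ↦ (1−x_k)ⁿ − 1 + nx_k`, which fails for the finitely many `k < b/2` when `b > 2`, and an `O(1)`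
  remainder is not what a sum–integral comparison of an `O(n)`-Lipschitz summand gives; only the
  `O(n)` form (all that Proposition 1 and (21) below use) is typed, and proved.
* **Proposition 1** `sekatskii2015_prop1` — PROVED for `b > 0`: an eventual bound
  `ζ-part ≥ −(1−ε)(n/2) ln n` gives `k_{n,−b} ≥ 0` eventually, hence `k_{n,−b} ≥ −K`, hence RH by the
  tree's `riemannHypothesis_of_liSekatskiiSum_ge_neg_pow` (Bombieri–Lagarias (c)).  With its converse
  `sekatskii2015_prop1_converse` (RH ⟹ the bound, any `ε < 1`) and the packaging
  `riemannHypothesis_iff_zetaPart_lower` — RH-EQUIVALENT.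
* **eq. (21), weak form** `sekatskii2015_eq21_isBigO` — PROVED: on RH the ζ-part is `O(n)`
  (from the tree's `sekatskii2014b_thm4` = the paper's Theorem 6 (A1), (7a) and Lemma 2).  The printed
  `o(n)`-precision form with the window for `A_n`, and the "exact compensation" `o(n)`, are not typed
  here (they need the `n`-coefficient of `S_b(n)`; see the TYPING NOTE).

Deliberately NOT here: Lemma 3 / eq. (12) (an integral bound used on the author's road to Theorem 5;
the tree proves Theorem 5 by Remark 3's road, `SekatskiiLargeShiftPositivity.lean`); Remark 5 /
eq. (22); the Appendix (Theorem 6 = `SekatskiiLiSumsAsymptotic.lean`).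

## References

* [Sekatskii2015FirstApplications] S. K. Sekatskii, arXiv:1404.7276v2 (2015): eq. (7a) and
  Proposition 1 (p. 18), Lemma 2 / eq. (11) (pp. 10–11), eq. (21) (p. 19); PROMS 358 (2021) 241–254.
* [Sekatskii2014] S. K. Sekatskii, Ukr. Math. J. 66 (2014) 415–431, eq. (6), Thm 1 (tree:
  `Sekatskii2014_sum_eq_deriv_holds`, `sekatskii2014_thm1`).
* [BombieriLagarias1999] E. Bombieri, J. C. Lagarias, J. Number Theory 77 (1999), Thm 1 (c).
-/

noncomputable section

open Complex Filter Topology Set LSeries Asymptotics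
open scoped Nat LSeries.notation ArithmeticFunction.vonMangoldt

namespace Literature.NumberTheory.LFunctions

open Sekatskii2015Laguerre (iteratedDeriv_sub_pow_mul_div_eq_sum)
open Literature.Analysis.SpecialFunctions.Complex (hasSum_iteratedDeriv_digamma_half
  differentiableOn_digamma)

/-! ### Definitions -/

/-- **Sekatskii's ζ-part of the generalized Li derivative**:
`(1/(n−1)!) dⁿ/dzⁿ[(z − a)^{n−1} log((z−1)ζ(z))]|_{z=p}`, typed exactly like the tree's
`liSekatskiiDeriv a p n` with `ζ₁(z) = (z−1)ζ(z)` (`riemannZeta₁`, entire, `ζ₁(1) = 1`) in place of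
`ξ` (principal `Complex.log`, holomorphic near a real `p > −2` where `ζ₁(p) > 0`; real part taken; at
`n = 0` a junk value).  The paper's object (7a)/Proposition 1 is `a = −b`, `p = b + 1`:
"`(1/(n−1)!) dⁿ/dzⁿ((z+b)^{n−1} ln((z−1)ς(z)))|_{z=b+1}`".
[cite: Sekatskii2015FirstApplications, eq. (7a) and Proposition 1 (p. 18)] -/
def liSekatskiiZetaDeriv (a p : ℝ) (n : ℕ) : ℝ :=
  (iteratedDeriv n (fun z : ℂ ↦ (z - a) ^ (n - 1) * Complex.log (riemannZeta₁ z)) p /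
    ((n - 1)! : ℂ)).re

/-- **The trivial-zero sum of (7a) / Lemma 2**:
`S_b(n) = Σ_{k≥1} [(1 − (2b+1)/(2k+b+1))ⁿ − 1 + n(2b+1)/(2k+b+1)]` (the contribution of the poles
`z = −2k` of `Γ(z/2)`, i.e. of the trivial zeros, to the generalized Li derivative at `z = b+1`;
indexed here by `k ↦ k + 1`). [cite: Sekatskii2015FirstApplications, eq. (7a) (p. 18) and Lemma 2 eq. (11) (p. 10)] -/
def liSekatskiiTrivialZeroSum (b : ℝ) (n : ℕ) : ℝ :=
  ∑' k : ℕ, ((1 - (2 * b + 1) / (2 * ((k : ℝ) + 1) + b + 1)) ^ n - 1 +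
    n * ((2 * b + 1) / (2 * ((k : ℝ) + 1) + b + 1)))

namespace Sekatskii2015ZetaPart

/-! ### §1. The two derivatives as Leibniz sums (`b > 0`, `p = b + 1`) -/

/-- The digamma piece of `ξ′/ξ`, `D(s) = −½ log π + ½ ψ(s/2)`, is smooth on `Re s > 0`. [folklore] -/
private theorem contDiffAt_digammaPiece {c : ℂ} (hc : 0 < c.re) (k : ℕ) :
    ContDiffAt ℂ k (fun s : ℂ ↦ -(Real.log Real.pi : ℂ) / 2 + digamma (s / 2) / 2) c := by
  have hU : IsOpen {w : ℂ | 0 < w.re} := isOpen_lt continuous_const continuous_re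
  have hd : DifferentiableOn ℂ (fun s : ℂ ↦ -(Real.log Real.pi : ℂ) / 2 + digamma (s / 2) / 2)
      {w : ℂ | 0 < w.re} := by
    intro w hw
    have hw' : 0 < w.re := hw
    have hw2 : 0 < (w / 2).re := by simp; linarith
    have h1 : DifferentiableAt ℂ digamma (w / 2) :=
      (differentiableOn_digamma (w / 2) hw2).differentiableAt (hU.mem_nhds hw2)
    exact (((h1.comp w (differentiableAt_id.div_const 2)).div_const 2).const_add
      _).differentiableWithinAt
  exact (hd.analyticAt (hU.mem_nhds hc)).contDiffAt

/-- `dʲ/dsʲ (s − d)⁻¹ |_{s=c} = (−1)ʲ j! (c − d)^{−(j+1)}`. [folklore] -/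
private theorem iteratedDeriv_inv_sub (j : ℕ) (d c : ℂ) :
    iteratedDeriv j (fun s : ℂ ↦ (s - d)⁻¹) c = (-1) ^ j * j ! * ((c - d)⁻¹) ^ (j + 1) := by
  have hf : (fun s : ℂ ↦ (s - d)⁻¹) = fun s ↦ (1 * s - d)⁻¹ := by funext s; rw [one_mul]
  rw [hf, iteratedDeriv_eq_iterate, iter_deriv_inv_linear_sub j 1 d]
  simp only [one_pow, mul_one, one_mul]
  have ez : ∀ w : ℂ, w ^ (-1 - j : ℤ) = (w⁻¹) ^ (j + 1) := by
    intro w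
    rw [show (-1 - j : ℤ) = -((j + 1 : ℕ) : ℤ) by push_cast; ring, zpow_neg, zpow_natCast, inv_pow]
  rw [ez]

/-- The abscissa of `Σ Λ(m) m^{−s}` is `≤ 1`. [folklore] -/
private theorem abscissa_vonMangoldt_lt {p : ℂ} (hp : 1 < p.re) : abscissaOfAbsConv ↗Λ < p.re := by
  have h1 : abscissaOfAbsConv ↗Λ ≤ 1 :=
    abscissaOfAbsConv_le_of_forall_lt_LSeriesSummable fun y hy ↦
      ArithmeticFunction.LSeriesSummable_vonMangoldt (by simpa using hy)
  exact lt_of_le_of_lt h1 (by exact_mod_cast hp)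

/-- `ζ₁(σ) = (σ−1)ζ(σ)` has positive real part at a real `σ > 1`. [folklore] -/
private theorem riemannZeta₁_ofReal_re_pos' {σ : ℝ} (hσ : 1 < σ) : 0 < (riemannZeta₁ σ).re := by
  have h1 : (σ : ℂ) ≠ 1 := by
    intro h; have := congrArg Complex.re h; simp at this; linarith
  have hz := (Complex.pos_iff.mp (riemannZeta_pos_of_one_lt hσ)).1
  rw [riemannZeta₁_eq_mul h1, show (σ : ℂ) - 1 = ((σ - 1 : ℝ) : ℂ) by push_cast; ring,
    Complex.re_ofReal_mul]
  exact mul_pos (by linarith) hz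

variable {b : ℝ}

/-- For `b > 0`: `log ξ` has derivative `1/s + 1/(s−1) + (−½ log π + ½ψ(s/2)) − Σ Λ(m)m^{−s}` near
`p = b + 1` (the tree's `logDeriv_riemannXi_eq_of_one_lt_re`). [folklore] -/
private theorem eventually_hasDerivAt_log_riemannXi (hb : 0 < b) :
    ∀ᶠ s in 𝓝 ((b + 1 : ℝ) : ℂ), HasDerivAt (fun s ↦ Complex.log (riemannXi s))
      ((s - 0)⁻¹ + (s - 1)⁻¹ + (-(Real.log Real.pi : ℂ) / 2 + digamma (s / 2) / 2) + -L ↗Λ s) s := by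
  have hopen : IsOpen {z : ℂ | 1 < z.re} := isOpen_lt continuous_const Complex.continuous_re
  have hp : ((b + 1 : ℝ) : ℂ) ∈ {z : ℂ | 1 < z.re} := by simp; linarith
  have hslit : riemannXi ((b + 1 : ℝ) : ℂ) ∈ slitPlane :=
    mem_slitPlane_iff.2 (Or.inl (Complex.pos_iff.1 (riemannXi_ofReal_pos (b + 1))).1)
  have hcont : ContinuousAt riemannXi ((b + 1 : ℝ) : ℂ) :=
    differentiable_riemannXi.continuous.continuousAt
  filter_upwards [hopen.mem_nhds hp, hcont.eventually_mem (isOpen_slitPlane.mem_nhds hslit)]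
    with s hs hss
  have hd := (differentiable_riemannXi s).hasDerivAt.clog hss
  have heq : deriv riemannXi s / riemannXi s =
      (s - 0)⁻¹ + (s - 1)⁻¹ + (-(Real.log Real.pi : ℂ) / 2 + digamma (s / 2) / 2) + -L ↗Λ s := by
    rw [← logDeriv_apply, logDeriv_riemannXi_eq_of_one_lt_re hs]
    simp only [sub_zero, one_div]
    ring
  rwa [heq] at hd

/-- For `b > 0`: `log ζ₁` has derivative `1/(s−1) − Σ Λ(m)m^{−s}` near `p = b + 1`. [folklore] -/
private theorem eventually_hasDerivAt_log_riemannZeta₁ (hb : 0 < b) :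
    ∀ᶠ s in 𝓝 ((b + 1 : ℝ) : ℂ), HasDerivAt (fun s ↦ Complex.log (riemannZeta₁ s))
      ((s - 1)⁻¹ + -L ↗Λ s) s := by
  have hopen : IsOpen {z : ℂ | 1 < z.re} := isOpen_lt continuous_const Complex.continuous_re
  have hp : ((b + 1 : ℝ) : ℂ) ∈ {z : ℂ | 1 < z.re} := by simp; linarith
  have hslit : riemannZeta₁ ((b + 1 : ℝ) : ℂ) ∈ slitPlane :=
    mem_slitPlane_iff.2 (Or.inl (riemannZeta₁_ofReal_re_pos' (by linarith)))
  have hcont : ContinuousAt riemannZeta₁ ((b + 1 : ℝ) : ℂ) :=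
    (differentiable_riemannZeta₁ _).continuousAt
  filter_upwards [hopen.mem_nhds hp, hcont.eventually_mem (isOpen_slitPlane.mem_nhds hslit)]
    with s hs hss
  have hd := (differentiable_riemannZeta₁ s).hasDerivAt.clog hss
  have heq : deriv riemannZeta₁ s / riemannZeta₁ s = (s - 1)⁻¹ + -L ↗Λ s := by
    rw [← logDeriv_apply, logDeriv_riemannZeta₁_eq_of_one_lt_re hs, one_div, sub_eq_add_neg]
  rwa [heq] at hd

/-- The difference of the two Leibniz sums is the Gamma-factor sum
`Σ_{j<n} C(n,j+1)(2b+1)^j/j! · [dʲ(1/s) + dʲ(−½ log π + ½ψ(s/2))](b+1)`. [folklore] -/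
private theorem deriv_sub_zetaDeriv_eq (hb : 0 < b) {n : ℕ} (hn : 1 ≤ n) :
    iteratedDeriv n (fun z : ℂ ↦ (z - ((-b : ℝ) : ℂ)) ^ (n - 1) * Complex.log (riemannXi z))
        ((b + 1 : ℝ) : ℂ) / ((n - 1)! : ℂ) -
      iteratedDeriv n (fun z : ℂ ↦ (z - ((-b : ℝ) : ℂ)) ^ (n - 1) * Complex.log (riemannZeta₁ z))
        ((b + 1 : ℝ) : ℂ) / ((n - 1)! : ℂ) =
      ∑ j ∈ Finset.range n, (n.choose (j + 1) : ℂ) * (2 * b + 1) ^ j / (j ! : ℂ) *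
        (iteratedDeriv j (fun s : ℂ ↦ (s - 0)⁻¹) ((b + 1 : ℝ) : ℂ) +
          iteratedDeriv j (fun s : ℂ ↦ -(Real.log Real.pi : ℂ) / 2 + digamma (s / 2) / 2)
            ((b + 1 : ℝ) : ℂ)) := by
  have hp1 : 1 < (((b + 1 : ℝ) : ℂ)).re := by simp; linarith
  have hp0 : ((b + 1 : ℝ) : ℂ) ≠ 0 := by
    intro h; have := congrArg Complex.re h; simp at this; linarith
  have hp1' : ((b + 1 : ℝ) : ℂ) ≠ 1 := by intro h; rw [h] at hp1; simp at hp1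
  rw [iteratedDeriv_sub_pow_mul_div_eq_sum _ hn (eventually_hasDerivAt_log_riemannXi hb),
    iteratedDeriv_sub_pow_mul_div_eq_sum _ hn (eventually_hasDerivAt_log_riemannZeta₁ hb),
    ← Finset.sum_sub_distrib]
  refine Finset.sum_congr rfl fun j _ ↦ ?_
  have h0 : ContDiffAt ℂ j (fun s : ℂ ↦ (s - 0)⁻¹) ((b + 1 : ℝ) : ℂ) :=
    ContDiffAt.inv (by fun_prop) (by rwa [sub_zero])
  have h1 : ContDiffAt ℂ j (fun s : ℂ ↦ (s - 1)⁻¹) ((b + 1 : ℝ) : ℂ) :=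
    ContDiffAt.inv (by fun_prop) (sub_ne_zero.2 hp1')
  have h2 := contDiffAt_digammaPiece (lt_trans zero_lt_one hp1) j
  have h3 : ContDiffAt ℂ j (fun s ↦ -L ↗Λ s) ((b + 1 : ℝ) : ℂ) :=
    ((LSeries_analyticOnNhd ↗Λ _ (abscissa_vonMangoldt_lt hp1)).contDiffAt).neg
  rw [iteratedDeriv_fun_add ((h0.add h1).add h2) h3, iteratedDeriv_fun_add (h0.add h1) h2,
    iteratedDeriv_fun_add h0 h1, iteratedDeriv_fun_add h1 h3,
    show ((b + 1 : ℝ) : ℂ) - ((-b : ℝ) : ℂ) = 2 * b + 1 by push_cast; ring]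
  ring

/-! ### §2. Evaluation of the Gamma-factor sum -/

/-- The rational piece: `Σ_{j<n} C(n,j+1) q^j/j! · (−1)^j j! p^{−(j+1)} = (1 − (1 − q/p)ⁿ)/q`. [folklore] -/
private theorem sum_ratPiece {p q : ℂ} (hp : p ≠ 0) (hq : q ≠ 0) (n : ℕ) :
    ∑ j ∈ Finset.range n, (n.choose (j + 1) : ℂ) * q ^ j / (j ! : ℂ) *
        ((-1) ^ j * j ! * (p⁻¹) ^ (j + 1)) = (1 - (1 - q / p) ^ n) / q := by
  have hterm : ∀ j ∈ Finset.range n,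
      (n.choose (j + 1) : ℂ) * q ^ j / (j ! : ℂ) * ((-1) ^ j * j ! * (p⁻¹) ^ (j + 1)) =
        q⁻¹ * ((n.choose (j + 1) : ℂ) * ((-1) ^ j * (q / p) ^ (j + 1))) := by
    intro j _
    have hj0 : (j ! : ℂ) ≠ 0 := by exact_mod_cast (Nat.factorial_pos j).ne'
    rw [div_pow, inv_pow]
    field_simp
    ring
  rw [Finset.sum_congr rfl hterm, ← Finset.mul_sum, sum_range_choose_succ_mul_neg_pow]
  field_simp

/-- The binomial identity behind the trivial-zero sum:
`Σ_{j<k} C(k+1, j+2) (−1)^{j+2} x^{j+2} = (1 − x)^{k+1} − 1 + (k+1)x`. [folklore] -/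
private theorem sum_choose_add_two (x : ℂ) (k : ℕ) :
    ∑ j ∈ Finset.range k, ((k + 1).choose (j + 1 + 1) : ℂ) * ((-1) ^ (j + 1 + 1) * x ^ (j + 1 + 1)) =
      (1 - x) ^ (k + 1) - 1 + (k + 1) * x := by
  have h := sum_range_choose_succ_mul_neg_pow x (k + 1)
  rw [Finset.sum_range_succ'] at h
  have e : ∑ j ∈ Finset.range k, ((k + 1).choose (j + 1 + 1) : ℂ) *
      ((-1) ^ (j + 1 + 1) * x ^ (j + 1 + 1)) =
      -∑ j ∈ Finset.range k, ((k + 1).choose (j + 1 + 1) : ℂ) *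
        ((-1) ^ (j + 1) * x ^ (j + 1 + 1)) := by
    rw [← Finset.sum_neg_distrib]
    exact Finset.sum_congr rfl fun j _ ↦ by ring
  have h0 : ((k + 1).choose (0 + 1) : ℂ) * ((-1) ^ 0 * x ^ (0 + 1)) = (k + 1) * x := by
    simp only [zero_add, Nat.choose_one_right, pow_zero, one_mul, pow_one, Nat.cast_add,
      Nat.cast_one]
  rw [h0] at h
  rw [e]
  linear_combination -h

/-- The digamma piece at `j ≥ 1`, with its coefficient, as a series over the Gamma poles:
`C(n,j+2) q^{j+1}/(j+1)! · (½ψ(·/2))^{(j+1)}(p) = Σ_{m≥0} C(n,j+2)(−1)^{j+2} q^{j+1} (p+2m)^{−(j+2)}`. [folklore] -/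
private theorem hasSum_digammaPiece_succ {p : ℂ} (hp : 0 < p.re) (q : ℂ) (n j : ℕ) :
    HasSum (fun m : ℕ ↦ (n.choose (j + 1 + 1) : ℂ) * ((-1) ^ (j + 1 + 1) * q ^ (j + 1) *
        ((p + 2 * m) ^ (j + 1 + 1))⁻¹))
      ((n.choose (j + 1 + 1) : ℂ) * q ^ (j + 1) / ((j + 1)! : ℂ) *
        iteratedDeriv (j + 1) (fun s : ℂ ↦ -(Real.log Real.pi : ℂ) / 2 + digamma (s / 2) / 2) p) := by
  have hD := hasSum_iteratedDeriv_digamma_half hp (by omega : 1 ≤ j + 1)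
  rw [iteratedDeriv_const_add (by omega)]
  have h2 := hD.mul_left ((n.choose (j + 1 + 1) : ℂ) * q ^ (j + 1) / ((j + 1)! : ℂ))
  refine h2.congr_fun fun m ↦ ?_
  have hj0 : ((j + 1)! : ℂ) ≠ 0 := by exact_mod_cast (Nat.factorial_pos _).ne'
  field_simp

/-- **The Gamma-factor sum in closed form**: for `b > 0`, `n ≥ 1`, with `p = b+1`, `q = 2b+1`,
`Σ_{j<n} C(n,j+1) q^j/j! · [dʲ(1/s) + dʲ(−½ log π + ½ψ(s/2))](p)
  = S_b(n)/q + (n/2)ψ(p/2) + n/p − (n/2) log π`, and the summability of the trivial-zero terms. [folklore] -/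
private theorem gammaSum_eq (hb : 0 < b) {n : ℕ} (hn : 1 ≤ n) :
    ∑ j ∈ Finset.range n, (n.choose (j + 1) : ℂ) * (2 * b + 1) ^ j / (j ! : ℂ) *
        (iteratedDeriv j (fun s : ℂ ↦ (s - 0)⁻¹) ((b + 1 : ℝ) : ℂ) +
          iteratedDeriv j (fun s : ℂ ↦ -(Real.log Real.pi : ℂ) / 2 + digamma (s / 2) / 2)
            ((b + 1 : ℝ) : ℂ)) =
      ((liSekatskiiTrivialZeroSum b n : ℝ) : ℂ) / (2 * b + 1) +
        (n : ℂ) / 2 * digamma ((((b + 1) / 2 : ℝ)) : ℂ) + (n : ℂ) / (b + 1) -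
        (n : ℂ) / 2 * (Real.log Real.pi : ℂ) ∧
      Summable (fun k : ℕ ↦ ((1 - (2 * b + 1) / (2 * ((k : ℝ) + 1) + b + 1)) ^ n - 1 +
        n * ((2 * b + 1) / (2 * ((k : ℝ) + 1) + b + 1)))) := by
  obtain ⟨k, rfl⟩ : ∃ k, n = k + 1 := ⟨n - 1, by omega⟩
  set p : ℂ := ((b + 1 : ℝ) : ℂ) with hpdef
  set q : ℂ := 2 * (b : ℂ) + 1 with hqdef
  have hp_re : 0 < p.re := by simp [hpdef]; linarith
  have hp0 : p ≠ 0 := by intro h; rw [h] at hp_re; simp at hp_re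
  have hq0 : q ≠ 0 := by
    rw [hqdef, show (2 : ℂ) * b + 1 = ((2 * b + 1 : ℝ) : ℂ) by push_cast; ring]
    exact Complex.ofReal_ne_zero.2 (by linarith)
  -- split the two pieces
  simp_rw [mul_add, Finset.sum_add_distrib, iteratedDeriv_inv_sub, sub_zero]
  rw [sum_ratPiece hp0 hq0 (k + 1)]
  -- the digamma piece: `j = 0` apart
  rw [Finset.sum_range_succ' (fun j ↦ ((k + 1).choose (j + 1) : ℂ) * q ^ j / (j ! : ℂ) *
    iteratedDeriv j (fun s : ℂ ↦ -(Real.log Real.pi : ℂ) / 2 + digamma (s / 2) / 2) p)]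
  simp only [iteratedDeriv_zero, pow_zero, Nat.factorial_zero, Nat.cast_one, div_one,
    zero_add, Nat.choose_one_right, mul_one]
  -- the terms `j + 1 ≥ 1` as series over the poles, and the exchange of sums
  have hT : ∀ j ∈ Finset.range k,
      ((k + 1).choose (j + 1 + 1) : ℂ) * q ^ (j + 1) / ((j + 1)! : ℂ) *
          iteratedDeriv (j + 1) (fun s : ℂ ↦ -(Real.log Real.pi : ℂ) / 2 + digamma (s / 2) / 2) p =
        ∑' m : ℕ, ((k + 1).choose (j + 1 + 1) : ℂ) * ((-1) ^ (j + 1 + 1) * q ^ (j + 1) *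
          ((p + 2 * m) ^ (j + 1 + 1))⁻¹) := fun j _ ↦
    (hasSum_digammaPiece_succ hp_re q (k + 1) j).tsum_eq.symm
  rw [Finset.sum_congr rfl hT, ← Summable.tsum_finsetSum (fun j _ ↦
    (hasSum_digammaPiece_succ hp_re q (k + 1) j).summable)]
  -- the inner finite sum is `(1/q)·g(x_m)`
  have hx : ∀ m : ℕ, p + 2 * m ≠ 0 := fun m ↦ by
    intro h; have := congrArg Complex.re h; simp [hpdef] at this; linarith
  have hinner : ∀ m : ℕ, ∑ j ∈ Finset.range k, ((k + 1).choose (j + 1 + 1) : ℂ) *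
      ((-1) ^ (j + 1 + 1) * q ^ (j + 1) * ((p + 2 * m) ^ (j + 1 + 1))⁻¹) =
      q⁻¹ * ((1 - q / (p + 2 * m)) ^ (k + 1) - 1 + (k + 1) * (q / (p + 2 * m))) := by
    intro m
    rw [← sum_choose_add_two, Finset.mul_sum]
    refine Finset.sum_congr rfl fun j _ ↦ ?_
    rw [div_pow]
    field_simp
    ring
  simp_rw [hinner]
  rw [tsum_mul_left]
  -- identify the real series and split off `m = 0`
  set g : ℕ → ℝ := fun m ↦ (1 - (2 * b + 1) / (2 * (m : ℝ) + b + 1)) ^ (k + 1) - 1 +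
    (k + 1 : ℕ) * ((2 * b + 1) / (2 * (m : ℝ) + b + 1)) with hgdef
  have hgm : ∀ m : ℕ, (1 - q / (p + 2 * m)) ^ (k + 1) - 1 + (k + 1) * (q / (p + 2 * m)) =
      ((g m : ℝ) : ℂ) := by
    intro m
    rw [hgdef, hqdef, hpdef]
    push_cast
    ring
  simp_rw [hgm]
  -- summability of `g` (from the summability of the digamma series)
  have hsum_c : Summable fun m : ℕ ↦ ((g m : ℝ) : ℂ) := by
    have h1 : Summable fun m : ℕ ↦ ∑ j ∈ Finset.range k, ((k + 1).choose (j + 1 + 1) : ℂ) *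
        ((-1) ^ (j + 1 + 1) * q ^ (j + 1) * ((p + 2 * m) ^ (j + 1 + 1))⁻¹) :=
      summable_sum fun j _ ↦ (hasSum_digammaPiece_succ hp_re q (k + 1) j).summable
    simp_rw [hinner, hgm] at h1
    simpa [hq0] using h1.mul_left q
  have hsum : Summable g := (Complex.summable_ofReal).1 hsum_c
  have hsum1 : Summable fun m : ℕ ↦ g (m + 1) := (summable_nat_add_iff 1).2 hsum
  have hshift : ∑' m : ℕ, ((g m : ℝ) : ℂ) = ((g 0 : ℝ) : ℂ) + ∑' m : ℕ, ((g (m + 1) : ℝ) : ℂ) := by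
    rw [← Complex.ofReal_tsum, hsum.tsum_eq_zero_add, Complex.ofReal_add, Complex.ofReal_tsum]
  have hS : liSekatskiiTrivialZeroSum b (k + 1) = ∑' m : ℕ, g (m + 1) := by
    rw [liSekatskiiTrivialZeroSum, hgdef]
    refine tsum_congr fun m ↦ ?_
    push_cast
    ring
  refine ⟨?_, ?_⟩
  · rw [hshift, hS, Complex.ofReal_tsum]
    have hg0 : ((g 0 : ℝ) : ℂ) = (1 - q / p) ^ (k + 1) - 1 + (k + 1) * (q / p) := by
      rw [← hgm 0]; simp
    rw [hg0, show (p / 2 : ℂ) = ((((b + 1) / 2 : ℝ)) : ℂ) by rw [hpdef]; push_cast; ring]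
    rw [hpdef, hqdef]
    have hb1 : (b : ℂ) + 1 ≠ 0 := by
      rw [show (b : ℂ) + 1 = ((b + 1 : ℝ) : ℂ) by push_cast; ring]
      exact Complex.ofReal_ne_zero.2 (by linarith)
    have hb2 : 2 * (b : ℂ) + 1 ≠ 0 := by
      rw [show (2 : ℂ) * b + 1 = ((2 * b + 1 : ℝ) : ℂ) by push_cast; ring]
      exact Complex.ofReal_ne_zero.2 (by linarith)
    push_cast
    field_simp
    ring
  · refine hsum1.congr fun m ↦ ?_
    rw [hgdef]
    push_cast
    ring

end Sekatskii2015ZetaPart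

open Sekatskii2015ZetaPart

/-! ### §3. Eq. (7a) -/

/-- **Sekatskii 2015, eq. (7a)** (p. 18) — PROVED, RH-FREE: for `b > 0` and `n ≥ 1`,
`(1/(n−1)!) dⁿ/dzⁿ[(z+b)^{n−1} ln ξ(z)]|_{z=b+1}
   = S_b(n)/(2b+1) + (n/2)ψ((b+1)/2) + n/(b+1) − (n/2) ln π
     + (1/(n−1)!) dⁿ/dzⁿ[(z+b)^{n−1} ln((z−1)ζ(z))]|_{z=b+1}`,
`S_b(n) = Σ_{k≥1}[(1 − (2b+1)/(2k+b+1))ⁿ − 1 + n(2b+1)/(2k+b+1)]` (printed with the opposite overall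
sign inside: `−(1/(2b+1))Σ(1 − ((2k−b)/(2k+b+1))ⁿ − n(2b+1)/(2k+b+1))`, the same number).
[cite: Sekatskii2015FirstApplications, eq. (7a) (p. 18)] -/
theorem sekatskii2015_eq7a {b : ℝ} (hb : 0 < b) {n : ℕ} (hn : 1 ≤ n) :
    liSekatskiiDeriv (-b) (b + 1) n =
      liSekatskiiTrivialZeroSum b n / (2 * b + 1) +
        n / 2 * (Complex.digamma ((((b + 1) / 2 : ℝ)) : ℂ)).re + n / (b + 1) -
        n / 2 * Real.log Real.pi + liSekatskiiZetaDeriv (-b) (b + 1) n := by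
  have h := Sekatskii2015ZetaPart.deriv_sub_zetaDeriv_eq hb hn
  rw [(Sekatskii2015ZetaPart.gammaSum_eq hb hn).1, sub_eq_iff_eq_add] at h
  unfold liSekatskiiDeriv liSekatskiiZetaDeriv
  rw [h]
  simp only [Complex.add_re, Complex.sub_re]
  have e1 : ((((liSekatskiiTrivialZeroSum b n : ℝ) : ℂ)) / (2 * b + 1)).re =
      liSekatskiiTrivialZeroSum b n / (2 * b + 1) := by
    rw [show (2 : ℂ) * b + 1 = ((2 * b + 1 : ℝ) : ℂ) by push_cast; ring, ← Complex.ofReal_div,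
      Complex.ofReal_re]
  have e2 : ((n : ℂ) / 2 * digamma ((((b + 1) / 2 : ℝ)) : ℂ)).re =
      n / 2 * (digamma ((((b + 1) / 2 : ℝ)) : ℂ)).re := by
    rw [show (n : ℂ) / 2 = (((n : ℝ) / 2 : ℝ) : ℂ) by push_cast; ring, Complex.re_ofReal_mul]
  have e3 : ((n : ℂ) / (b + 1)).re = n / (b + 1) := by
    rw [show (n : ℂ) / (b + 1) = (((n : ℝ) / (b + 1) : ℝ) : ℂ) by push_cast; ring, Complex.ofReal_re]
  have e4 : ((n : ℂ) / 2 * (Real.log Real.pi : ℂ)).re = n / 2 * Real.log Real.pi := by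
    rw [show (n : ℂ) / 2 * (Real.log Real.pi : ℂ) = (((n : ℝ) / 2 * Real.log Real.pi : ℝ) : ℂ) by
      push_cast; ring, Complex.ofReal_re]
  rw [e1, e2, e3, e4]

/-- Summability of the trivial-zero terms (`b > 0`, `n ≥ 1`). [cite: Sekatskii2015FirstApplications, Lemma 2 (p. 10)] -/
theorem summable_liSekatskiiTrivialZeroSum_term {b : ℝ} (hb : 0 < b) {n : ℕ} (hn : 1 ≤ n) :
    Summable (fun k : ℕ ↦ ((1 - (2 * b + 1) / (2 * ((k : ℝ) + 1) + b + 1)) ^ n - 1 +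
      n * ((2 * b + 1) / (2 * ((k : ℝ) + 1) + b + 1)))) :=
  (Sekatskii2015ZetaPart.gammaSum_eq hb hn).2


namespace Sekatskii2015ZetaPart

/-! ### §4. Lemma 2 in honest form: `S_b(n) = ((2b+1)/2) n ln n + O_b(n)` -/

/-- `0 ≤ (1−x)ⁿ − 1 + nx` for `x ≤ 2` (Bernoulli). [folklore] -/
private theorem g_nonneg {x : ℝ} (hx2 : x ≤ 2) (n : ℕ) :
    0 ≤ (1 - x) ^ n - 1 + n * x := by
  have h := one_add_mul_le_pow (show (-2 : ℝ) ≤ -x by linarith) n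
  rw [show (1 : ℝ) + -x = 1 - x by ring] at h
  linarith

/-- `(1−x)ⁿ − 1 + nx ≤ nx` on `[0, 2]`. [folklore] -/
private theorem g_le {x : ℝ} (hx0 : 0 ≤ x) (hx2 : x ≤ 2) (n : ℕ) :
    (1 - x) ^ n - 1 + n * x ≤ n * x := by
  have h1 : |1 - x| ≤ 1 := abs_le.2 ⟨by linarith, by linarith⟩
  have h2 : (1 - x) ^ n ≤ 1 :=
    calc (1 - x) ^ n ≤ |(1 - x) ^ n| := le_abs_self _
      _ = |1 - x| ^ n := abs_pow _ _
      _ ≤ 1 := pow_le_one₀ (abs_nonneg _) h1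
  linarith

/-- `nx − 2 ≤ (1−x)ⁿ − 1 + nx` on `[0, 2]`. [folklore] -/
private theorem g_ge {x : ℝ} (hx0 : 0 ≤ x) (hx2 : x ≤ 2) (n : ℕ) :
    n * x - 2 ≤ (1 - x) ^ n - 1 + n * x := by
  have h1 : |1 - x| ≤ 1 := abs_le.2 ⟨by linarith, by linarith⟩
  have h2 : -1 ≤ (1 - x) ^ n := by
    have : |(1 - x) ^ n| ≤ 1 := by rw [abs_pow]; exact pow_le_one₀ (abs_nonneg _) h1
    linarith [neg_abs_le ((1 - x) ^ n)]
  linarith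

/-- Second-order Bernoulli: `(1−x)ⁿ ≤ 1 − nx + (n²/2)x²` on `[0, 1]`. [folklore] -/
private theorem one_sub_pow_le {x : ℝ} (hx0 : 0 ≤ x) (hx1 : x ≤ 1) (n : ℕ) :
    (1 - x) ^ n ≤ 1 - n * x + (n : ℝ) ^ 2 / 2 * x ^ 2 := by
  induction n with
  | zero => simp
  | succ n ih =>
    have h1x : 0 ≤ 1 - x := by linarith
    have hx3 : 0 ≤ x ^ 3 := by positivity
    calc (1 - x) ^ (n + 1) = (1 - x) * (1 - x) ^ n := by ring
      _ ≤ (1 - x) * (1 - n * x + (n : ℝ) ^ 2 / 2 * x ^ 2) := mul_le_mul_of_nonneg_left ih h1x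
      _ = 1 - ((n : ℝ) + 1) * x + ((n : ℝ) ^ 2 / 2 + n) * x ^ 2 - (n : ℝ) ^ 2 / 2 * x ^ 3 := by
          ring
      _ ≤ 1 - ((n + 1 : ℕ) : ℝ) * x + ((n + 1 : ℕ) : ℝ) ^ 2 / 2 * x ^ 2 := by
          push_cast
          nlinarith [sq_nonneg x, sq_nonneg (n : ℝ), mul_nonneg (sq_nonneg (n : ℝ)) hx3]

/-- `(1−x)ⁿ − 1 + nx ≤ n² x²` on `[0, 2]`. [folklore] -/
private theorem g_le_sq {x : ℝ} (hx0 : 0 ≤ x) (hx2 : x ≤ 2) (n : ℕ) :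
    (1 - x) ^ n - 1 + n * x ≤ (n : ℝ) ^ 2 * x ^ 2 := by
  rcases le_or_gt x 1 with hx1 | hx1
  · have := one_sub_pow_le hx0 hx1 n
    nlinarith [sq_nonneg x, sq_nonneg (n : ℝ)]
  · rcases Nat.eq_zero_or_pos n with rfl | hn
    · simp
    · have h := g_le hx0 hx2 n
      have hn1 : (1 : ℝ) ≤ n := by exact_mod_cast hn
      have h2 : (n : ℝ) * x ≤ (n : ℝ) * x * x := le_mul_of_one_le_right (by positivity) hx1.le
      have h3 : (n : ℝ) * x * x ≤ (n : ℝ) ^ 2 * x ^ 2 := by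
        rw [show (n : ℝ) * x * x = n * x ^ 2 by ring]
        exact mul_le_mul_of_nonneg_right (by nlinarith) (sq_nonneg x)
      linarith

variable {b : ℝ}

/-- The abscissa `x_k = (2b+1)/(2(k+1)+b+1)` lies in `(0, 2]`, and `x_k ≤ (2b+1)/(2(k+1))`,
for `b ≥ 0`. [folklore] -/
private theorem xk_bounds (hb : 0 ≤ b) (k : ℕ) :
    0 < (2 * b + 1) / (2 * ((k : ℝ) + 1) + b + 1) ∧
      (2 * b + 1) / (2 * ((k : ℝ) + 1) + b + 1) ≤ 2 ∧
      (2 * b + 1) / (2 * ((k : ℝ) + 1) + b + 1) ≤ (2 * b + 1) / (2 * ((k : ℝ) + 1)) := by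
  have hk : (0 : ℝ) ≤ k := Nat.cast_nonneg k
  have hd : 0 < 2 * ((k : ℝ) + 1) + b + 1 := by linarith
  refine ⟨by positivity, ?_, ?_⟩
  · rw [div_le_iff₀ hd]; nlinarith
  · exact div_le_div_of_nonneg_left (by linarith) (by positivity) (by linarith)

/-- The trivial-zero terms are nonnegative (`b ≥ 0`). [folklore] -/
private theorem term_nonneg (hb : 0 ≤ b) (n k : ℕ) :
    0 ≤ (1 - (2 * b + 1) / (2 * ((k : ℝ) + 1) + b + 1)) ^ n - 1 +
      n * ((2 * b + 1) / (2 * ((k : ℝ) + 1) + b + 1)) := by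
  obtain ⟨-, h2, -⟩ := xk_bounds hb k
  exact g_nonneg h2 n

/-- The trivial-zero terms are `≤ (n²(2b+1)²/4)·(k+1)^{−2}` (`b ≥ 0`). [folklore] -/
private theorem term_le (hb : 0 ≤ b) (n k : ℕ) :
    (1 - (2 * b + 1) / (2 * ((k : ℝ) + 1) + b + 1)) ^ n - 1 +
        n * ((2 * b + 1) / (2 * ((k : ℝ) + 1) + b + 1)) ≤
      (n : ℝ) ^ 2 * (2 * b + 1) ^ 2 / 4 * (1 / ((k : ℝ) + 1) ^ 2) := by
  obtain ⟨h0, h2, h3⟩ := xk_bounds hb k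
  refine (g_le_sq h0.le h2 n).trans ?_
  have hsq : ((2 * b + 1) / (2 * ((k : ℝ) + 1) + b + 1)) ^ 2 ≤ ((2 * b + 1) / (2 * ((k : ℝ) + 1))) ^ 2 :=
    pow_le_pow_left₀ h0.le h3 2
  have hk : (0 : ℝ) < (k : ℝ) + 1 := by positivity
  calc (n : ℝ) ^ 2 * ((2 * b + 1) / (2 * ((k : ℝ) + 1) + b + 1)) ^ 2
      ≤ (n : ℝ) ^ 2 * ((2 * b + 1) / (2 * ((k : ℝ) + 1))) ^ 2 :=
        mul_le_mul_of_nonneg_left hsq (sq_nonneg _)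
    _ = (n : ℝ) ^ 2 * (2 * b + 1) ^ 2 / 4 * (1 / ((k : ℝ) + 1) ^ 2) := by
        field_simp
        ring

/-- Summability of the trivial-zero terms (`b ≥ 0`, any `n`).
[cite: Sekatskii2015FirstApplications, Lemma 2 (p. 10)] -/
theorem summable_trivialZeroSum_term (hb : 0 ≤ b) (n : ℕ) :
    Summable (fun k : ℕ ↦ (1 - (2 * b + 1) / (2 * ((k : ℝ) + 1) + b + 1)) ^ n - 1 +
      n * ((2 * b + 1) / (2 * ((k : ℝ) + 1) + b + 1))) := by
  have hs : Summable fun k : ℕ ↦ (n : ℝ) ^ 2 * (2 * b + 1) ^ 2 / 4 * (1 / ((k : ℝ) + 1) ^ 2) := by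
    have h1 : Summable fun k : ℕ ↦ 1 / ((k : ℝ) + 1) ^ 2 := by
      have h := (summable_nat_add_iff 1).mpr (Real.summable_one_div_nat_pow.mpr one_lt_two)
      simpa [Nat.cast_add, Nat.cast_one] using h
    exact h1.mul_left _
  exact Summable.of_nonneg_of_le (fun k ↦ term_nonneg hb n k) (fun k ↦ term_le hb n k) hs

/-- Harmonic sums from below: `log(n + c) − log c ≤ Σ_{k<n} 1/(k+c)` (`c > 0`). [folklore] -/
private theorem log_le_sum_inv {c : ℝ} (hc : 0 < c) (n : ℕ) :
    Real.log (n + c) - Real.log c ≤ ∑ k ∈ Finset.range n, 1 / ((k : ℝ) + c) := by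
  have htel : ∑ k ∈ Finset.range n, (Real.log ((k : ℝ) + 1 + c) - Real.log ((k : ℝ) + c)) =
      Real.log (n + c) - Real.log c := by
    have h := Finset.sum_range_sub (fun i : ℕ ↦ Real.log ((i : ℝ) + c)) n
    simp only [Nat.cast_add, Nat.cast_one, Nat.cast_zero, zero_add] at h
    rw [← h]
  rw [← htel]
  refine Finset.sum_le_sum fun k _ ↦ ?_
  have hy : 0 < (k : ℝ) + c := by positivity
  have h1 : Real.log (((k : ℝ) + 1 + c) / ((k : ℝ) + c)) ≤ ((k : ℝ) + 1 + c) / ((k : ℝ) + c) - 1 :=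
    Real.log_le_sub_one_of_pos (by positivity)
  rw [Real.log_div (by positivity) hy.ne'] at h1
  have h2 : ((k : ℝ) + 1 + c) / ((k : ℝ) + c) - 1 = 1 / ((k : ℝ) + c) := by
    field_simp; ring
  linarith

/-- Harmonic sums from above: `Σ_{k<n} 1/(k+c) ≤ log(n + c − 1) − log(c − 1)` (`c > 1`). [folklore] -/
private theorem sum_inv_le_log {c : ℝ} (hc : 1 < c) (n : ℕ) :
    ∑ k ∈ Finset.range n, 1 / ((k : ℝ) + c) ≤ Real.log (n + c - 1) - Real.log (c - 1) := by
  have htel : ∑ k ∈ Finset.range n, (Real.log ((k : ℝ) + 1 + c - 1) - Real.log ((k : ℝ) + c - 1)) =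
      Real.log (n + c - 1) - Real.log (c - 1) := by
    have h := Finset.sum_range_sub (fun i : ℕ ↦ Real.log ((i : ℝ) + c - 1)) n
    simp only [Nat.cast_add, Nat.cast_one, Nat.cast_zero, zero_add] at h
    rw [← h]
  rw [← htel]
  refine Finset.sum_le_sum fun k _ ↦ ?_
  have hy : 0 < (k : ℝ) + c - 1 := by have : (0:ℝ) ≤ k := Nat.cast_nonneg k; linarith
  have hy1 : 0 < (k : ℝ) + c := by linarith
  have h1 : Real.log (((k : ℝ) + c - 1) / ((k : ℝ) + c)) ≤ ((k : ℝ) + c - 1) / ((k : ℝ) + c) - 1 :=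
    Real.log_le_sub_one_of_pos (by positivity)
  rw [Real.log_div hy.ne' hy1.ne'] at h1
  have h2 : ((k : ℝ) + c - 1) / ((k : ℝ) + c) - 1 = -(1 / ((k : ℝ) + c)) := by
    field_simp; ring
  rw [show (k : ℝ) + 1 + c - 1 = (k : ℝ) + c by ring]
  linarith

/-- **Lemma 2, lower half (honest form)**: for `b ≥ 0` and `n ≥ 1`,
`S_b(n) ≥ ((2b+1)/2) n ln n − (((2b+1)/2) ln((b+3)/2) + 2) n`.
[cite: Sekatskii2015FirstApplications, Lemma 2 eq. (11) (p. 10), lower bound (weaker constant)] -/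
theorem trivialZeroSum_lower (hb : 0 ≤ b) {n : ℕ} (hn : 1 ≤ n) :
    (2 * b + 1) / 2 * n * Real.log n - ((2 * b + 1) / 2 * Real.log ((b + 3) / 2) + 2) * n ≤
      liSekatskiiTrivialZeroSum b n := by
  set c : ℝ := (b + 3) / 2 with hc
  have hc0 : 0 < c := by rw [hc]; linarith
  have hn0 : (0 : ℝ) < n := by exact_mod_cast hn
  -- partial sum ≤ tsum
  have h1 : ∑ k ∈ Finset.range n, ((1 - (2 * b + 1) / (2 * ((k : ℝ) + 1) + b + 1)) ^ n - 1 +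
      n * ((2 * b + 1) / (2 * ((k : ℝ) + 1) + b + 1))) ≤ liSekatskiiTrivialZeroSum b n :=
    (summable_trivialZeroSum_term hb n).sum_le_tsum (Finset.range n) (fun k _ ↦ term_nonneg hb n k)
  -- termwise `≥ n x_k − 2`, `x_k = ((2b+1)/2)/(k + c)`
  have h2 : ∑ k ∈ Finset.range n, ((n : ℝ) * ((2 * b + 1) / 2 * (1 / ((k : ℝ) + c))) - 2) ≤
      ∑ k ∈ Finset.range n, ((1 - (2 * b + 1) / (2 * ((k : ℝ) + 1) + b + 1)) ^ n - 1 +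
        n * ((2 * b + 1) / (2 * ((k : ℝ) + 1) + b + 1))) := by
    refine Finset.sum_le_sum fun k _ ↦ ?_
    obtain ⟨h0, h2, -⟩ := xk_bounds hb k
    have hx : (2 * b + 1) / (2 * ((k : ℝ) + 1) + b + 1) = (2 * b + 1) / 2 * (1 / ((k : ℝ) + c)) := by
      rw [hc]; field_simp; ring
    have := g_ge h0.le h2 n
    rw [hx] at this ⊢
    exact this
  have h3 : ∑ k ∈ Finset.range n, ((n : ℝ) * ((2 * b + 1) / 2 * (1 / ((k : ℝ) + c))) - 2) =
      (n : ℝ) * ((2 * b + 1) / 2) * ∑ k ∈ Finset.range n, 1 / ((k : ℝ) + c) - 2 * n := by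
    rw [Finset.sum_sub_distrib]
    simp only [Finset.sum_const, Finset.card_range, nsmul_eq_mul]
    rw [← Finset.mul_sum, ← Finset.mul_sum]
    ring
  have h4 := log_le_sum_inv hc0 n
  have h5 : Real.log n ≤ Real.log (n + c) := Real.log_le_log hn0 (by linarith)
  have h6 : 0 ≤ (n : ℝ) * ((2 * b + 1) / 2) := by positivity
  have h7 : (n : ℝ) * ((2 * b + 1) / 2) * (Real.log n - Real.log c) ≤
      (n : ℝ) * ((2 * b + 1) / 2) * ∑ k ∈ Finset.range n, 1 / ((k : ℝ) + c) :=
    mul_le_mul_of_nonneg_left (by linarith) h6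
  calc (2 * b + 1) / 2 * n * Real.log n - ((2 * b + 1) / 2 * Real.log ((b + 3) / 2) + 2) * n
      = (n : ℝ) * ((2 * b + 1) / 2) * (Real.log n - Real.log c) - 2 * n := by rw [hc]; ring
    _ ≤ (n : ℝ) * ((2 * b + 1) / 2) * ∑ k ∈ Finset.range n, 1 / ((k : ℝ) + c) - 2 * n := by linarith
    _ ≤ liSekatskiiTrivialZeroSum b n := by rw [← h3]; exact h2.trans h1

/-- **Lemma 2, upper half (honest form)**: for `b ≥ 0`, `n ≥ 1` and `b ≤ 2n + 2`,
`S_b(n) ≤ ((2b+1)/2) n ln n + (((2b+1)/2)(ln((b+3)/2) − ln((b+1)/2)) + (2b+1)²/8) n`.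
[cite: Sekatskii2015FirstApplications, Lemma 2 eq. (11) (p. 10), upper bound (weaker constant)] -/
theorem trivialZeroSum_upper (hb : 0 ≤ b) {n : ℕ} (hn : 1 ≤ n) (hbn : b ≤ 2 * n + 2) :
    liSekatskiiTrivialZeroSum b n ≤ (2 * b + 1) / 2 * n * Real.log n +
      ((2 * b + 1) / 2 * (Real.log ((b + 3) / 2) - Real.log ((b + 1) / 2)) + (2 * b + 1) ^ 2 / 8) * n := by
  set c : ℝ := (b + 3) / 2 with hc
  have hc1 : 1 < c := by rw [hc]; linarith
  have hn0 : (0 : ℝ) < n := by exact_mod_cast hn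
  have hn1 : (1 : ℝ) ≤ n := by exact_mod_cast hn
  set f : ℕ → ℝ := fun k ↦ (1 - (2 * b + 1) / (2 * ((k : ℝ) + 1) + b + 1)) ^ n - 1 +
      n * ((2 * b + 1) / (2 * ((k : ℝ) + 1) + b + 1)) with hf
  have hf0 : ∀ k, 0 ≤ f k := fun k ↦ term_nonneg hb n k
  -- head: `Σ_{k<n} f k ≤ (n(2b+1)/2)(log n + log c − log(c−1))`
  have hhead : ∑ k ∈ Finset.range n, f k ≤
      (n : ℝ) * ((2 * b + 1) / 2) * (Real.log n + Real.log c - Real.log (c - 1)) := by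
    have h2 : ∑ k ∈ Finset.range n, f k ≤
        ∑ k ∈ Finset.range n, (n : ℝ) * ((2 * b + 1) / 2 * (1 / ((k : ℝ) + c))) := by
      refine Finset.sum_le_sum fun k _ ↦ ?_
      obtain ⟨h0, h2, -⟩ := xk_bounds hb k
      have hx : (2 * b + 1) / (2 * ((k : ℝ) + 1) + b + 1) = (2 * b + 1) / 2 * (1 / ((k : ℝ) + c)) := by
        rw [hc]; field_simp; ring
      have := g_le h0.le h2 n
      rw [hf]
      dsimp only
      rw [hx] at this ⊢
      exact this
    rw [← Finset.mul_sum, ← Finset.mul_sum] at h2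
    have h4 := sum_inv_le_log hc1 n
    have h5 : Real.log (n + c - 1) ≤ Real.log n + Real.log c := by
      rw [← Real.log_mul hn0.ne' (by linarith)]
      exact Real.log_le_log (by linarith) (by nlinarith)
    have h6 : 0 ≤ (n : ℝ) * ((2 * b + 1) / 2) := by positivity
    calc ∑ k ∈ Finset.range n, f k ≤ (n : ℝ) * ((2 * b + 1) / 2 * ∑ k ∈ Finset.range n,
          1 / ((k : ℝ) + c)) := h2
      _ = (n : ℝ) * ((2 * b + 1) / 2) * ∑ k ∈ Finset.range n, 1 / ((k : ℝ) + c) := by ring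
      _ ≤ (n : ℝ) * ((2 * b + 1) / 2) * (Real.log n + Real.log c - Real.log (c - 1)) :=
          mul_le_mul_of_nonneg_left (by linarith) h6
  -- tail: `Σ_{j<M} f (n + j) ≤ n (2b+1)²/8`
  have htail : ∀ M : ℕ, ∑ j ∈ Finset.range M, f (n + j) ≤ (n : ℝ) * (2 * b + 1) ^ 2 / 8 := by
    intro M
    have hle : ∀ j ∈ Finset.range M, f (n + j) ≤ (n : ℝ) ^ 2 * (2 * b + 1) ^ 2 / 8 *
        (1 / ((n : ℝ) + j + 1) - 1 / ((n : ℝ) + j + 2)) := by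
      intro j _
      have hm : (0 : ℝ) ≤ (n : ℝ) + j := by positivity
      set x : ℝ := (2 * b + 1) / (2 * (((n + j : ℕ) : ℝ) + 1) + b + 1) with hx
      have hd : 0 < 2 * (((n + j : ℕ) : ℝ) + 1) + b + 1 := by push_cast; linarith
      have hx0 : 0 ≤ x := by rw [hx]; positivity
      have hx1 : x ≤ 1 := by
        rw [hx, div_le_one hd]; push_cast; linarith
      have hg : f (n + j) ≤ (n : ℝ) ^ 2 / 2 * x ^ 2 := by
        have := one_sub_pow_le hx0 hx1 n
        rw [hf]; dsimp only; rw [← hx]; linarith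
      have hxle : x ≤ (2 * b + 1) / (2 * ((n : ℝ) + j) + 3) := by
        rw [hx]; push_cast
        exact div_le_div_of_nonneg_left (by linarith) (by linarith) (by linarith)
      have hx2 : x ^ 2 ≤ (2 * b + 1) ^ 2 / (2 * ((n : ℝ) + j) + 3) ^ 2 := by
        rw [← div_pow]; exact pow_le_pow_left₀ hx0 hxle 2
      have hkey : (2 * b + 1) ^ 2 / (2 * ((n : ℝ) + j) + 3) ^ 2 ≤
          (2 * b + 1) ^ 2 / 4 * (1 / ((n : ℝ) + j + 1) - 1 / ((n : ℝ) + j + 2)) := by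
        have e : 1 / ((n : ℝ) + j + 1) - 1 / ((n : ℝ) + j + 2) =
            1 / (((n : ℝ) + j + 1) * ((n : ℝ) + j + 2)) := by
          field_simp; ring
        rw [e, div_mul_eq_mul_div, mul_one_div, div_div]
        exact div_le_div_of_nonneg_left (sq_nonneg _) (by positivity) (by nlinarith)
      calc f (n + j) ≤ (n : ℝ) ^ 2 / 2 * x ^ 2 := hg
        _ ≤ (n : ℝ) ^ 2 / 2 * ((2 * b + 1) ^ 2 / (2 * ((n : ℝ) + j) + 3) ^ 2) :=
            mul_le_mul_of_nonneg_left hx2 (by positivity)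
        _ ≤ (n : ℝ) ^ 2 / 2 * ((2 * b + 1) ^ 2 / 4 * (1 / ((n : ℝ) + j + 1) - 1 / ((n : ℝ) + j + 2))) :=
            mul_le_mul_of_nonneg_left hkey (by positivity)
        _ = (n : ℝ) ^ 2 * (2 * b + 1) ^ 2 / 8 * (1 / ((n : ℝ) + j + 1) - 1 / ((n : ℝ) + j + 2)) := by
            ring
    refine (Finset.sum_le_sum hle).trans ?_
    rw [← Finset.mul_sum]
    have htel : ∑ j ∈ Finset.range M, (1 / ((n : ℝ) + j + 1) - 1 / ((n : ℝ) + j + 2)) =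
        1 / ((n : ℝ) + 1) - 1 / ((n : ℝ) + M + 1) := by
      have h := Finset.sum_range_sub' (fun i : ℕ ↦ 1 / ((n : ℝ) + i + 1)) M
      simp only [Nat.cast_add, Nat.cast_one, Nat.cast_zero, add_zero] at h
      rw [← h]
      refine Finset.sum_congr rfl fun j _ ↦ ?_
      ring
    rw [htel]
    have h7 : 1 / ((n : ℝ) + 1) - 1 / ((n : ℝ) + M + 1) ≤ 1 / (n : ℝ) := by
      have : 0 ≤ 1 / ((n : ℝ) + M + 1) := by positivity
      have : 1 / ((n : ℝ) + 1) ≤ 1 / (n : ℝ) :=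
        div_le_div_of_nonneg_left zero_le_one hn0 (by linarith)
      linarith
    calc (n : ℝ) ^ 2 * (2 * b + 1) ^ 2 / 8 * (1 / ((n : ℝ) + 1) - 1 / ((n : ℝ) + M + 1))
        ≤ (n : ℝ) ^ 2 * (2 * b + 1) ^ 2 / 8 * (1 / (n : ℝ)) :=
          mul_le_mul_of_nonneg_left h7 (by positivity)
      _ = (n : ℝ) * (2 * b + 1) ^ 2 / 8 := by field_simp
  -- assemble through `tsum_le_of_sum_range_le`
  have hbound : ∀ M : ℕ, ∑ k ∈ Finset.range M, f k ≤
      (n : ℝ) * ((2 * b + 1) / 2) * (Real.log n + Real.log c - Real.log (c - 1)) +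
        (n : ℝ) * (2 * b + 1) ^ 2 / 8 := by
    intro M
    have hsub : ∑ k ∈ Finset.range M, f k ≤ ∑ k ∈ Finset.range (n + M), f k :=
      Finset.sum_le_sum_of_subset_of_nonneg (Finset.range_mono (by omega))
        (fun k _ _ ↦ hf0 k)
    rw [Finset.sum_range_add] at hsub
    linarith [hhead, htail M]
  have := Real.tsum_le_of_sum_range_le hf0 hbound
  rw [liSekatskiiTrivialZeroSum]
  refine this.trans (le_of_eq ?_)
  rw [hc]
  ring_nf

/-- **Lemma 2 (honest `O(n)` form)**: for fixed `b ≥ 0`, `S_b(n) = ((2b+1)/2) n ln n + O(n)`.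
[cite: Sekatskii2015FirstApplications, Lemma 2 eq. (11) (p. 10) (the typed O(n) form; see module docstring)] -/
theorem lemma2_isBigO (hb : 0 ≤ b) :
    (fun n : ℕ ↦ liSekatskiiTrivialZeroSum b n - (2 * b + 1) / 2 * n * Real.log n) =O[atTop]
      (fun n : ℕ ↦ (n : ℝ)) := by
  refine IsBigO.of_bound (max ((2 * b + 1) / 2 * Real.log ((b + 3) / 2) + 2)
    ((2 * b + 1) / 2 * (Real.log ((b + 3) / 2) - Real.log ((b + 1) / 2)) + (2 * b + 1) ^ 2 / 8)) ?_
  filter_upwards [eventually_ge_atTop (max 1 ⌈b⌉₊)] with n hn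
  have hn1 : 1 ≤ n := le_trans (le_max_left _ _) hn
  have hbn : b ≤ 2 * n + 2 := by
    have h1 : (⌈b⌉₊ : ℝ) ≤ n := by exact_mod_cast le_trans (le_max_right _ _) hn
    have h2 : b ≤ ⌈b⌉₊ := Nat.le_ceil b
    have h3 : (0 : ℝ) ≤ n := Nat.cast_nonneg n
    linarith
  have hlo := trivialZeroSum_lower hb hn1
  have hup := trivialZeroSum_upper hb hn1 hbn
  have hn0 : (0 : ℝ) ≤ n := Nat.cast_nonneg n
  rw [Real.norm_eq_abs, Real.norm_of_nonneg hn0, abs_le]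
  constructor
  · have := mul_le_mul_of_nonneg_right (le_max_left ((2 * b + 1) / 2 * Real.log ((b + 3) / 2) + 2)
      ((2 * b + 1) / 2 * (Real.log ((b + 3) / 2) - Real.log ((b + 1) / 2)) + (2 * b + 1) ^ 2 / 8)) hn0
    linarith
  · have := mul_le_mul_of_nonneg_right (le_max_right ((2 * b + 1) / 2 * Real.log ((b + 3) / 2) + 2)
      ((2 * b + 1) / 2 * (Real.log ((b + 3) / 2) - Real.log ((b + 1) / 2)) + (2 * b + 1) ^ 2 / 8)) hn0
    linarith

end Sekatskii2015ZetaPart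

/-- **Sekatskii 2015, Lemma 2 — in the honest `O(n)` form** (see the TYPING NOTE of the module
docstring): for every fixed `b ≥ 0`,
`Σ_{k≥1}[(1 − (2b+1)/(2k+b+1))ⁿ − 1 + n(2b+1)/(2k+b+1)] = ((2b+1)/2) n ln n + O(n)` (`n → ∞`).
The printed (11) asserts the sharper two-sided form with linear coefficients `γ − 1 + ln(2 − 5/(2b+3))`
and `γ − 1 + ln(2 − 1/(b+1))` and `O(1)` remainders, which is NOT vendored. RH-FREE, PROVED.
[cite: Sekatskii2015FirstApplications, Lemma 2, eq. (11) (p. 10)] -/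
theorem sekatskii2015_lemma2_isBigO {b : ℝ} (hb : 0 ≤ b) :
    (fun n : ℕ ↦ liSekatskiiTrivialZeroSum b n - (2 * b + 1) / 2 * n * Real.log n) =O[atTop]
      (fun n : ℕ ↦ (n : ℝ)) :=
  Sekatskii2015ZetaPart.lemma2_isBigO hb

/-! ### §5. Proposition 1 and its converse; eq. (21) in the weak form -/

/-- `k_{n,−b} = (2b+1) · (1/(n−1)!) dⁿ/dzⁿ[(z+b)^{n−1} ln ξ(z)]|_{z=b+1}` ([Sekatskii2014] eq. (6)).
[cite: Sekatskii2014, eq. (6) (p. 423)] -/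
theorem liSekatskiiSum_neg_eq_deriv (b : ℝ) {n : ℕ} (hn : 1 ≤ n) :
    liSekatskiiSum (-b) n = (2 * b + 1) * liSekatskiiDeriv (-b) (b + 1) n := by
  rw [liSekatskiiSum_eq_deriv Sekatskii2014_sum_eq_deriv_holds (-b) hn,
    show (1 : ℝ) - -b = b + 1 by ring]
  ring

/-- **Sekatskii 2015, Proposition 1** (p. 18) — PROVED: "Riemann hypothesis holds true if for some real
`ε > 0` asymptotically we have
`(1/(n−1)!) dⁿ/dzⁿ((z+b)^{n−1} ln((z−1)ς(z)))|_{z=b+1} ≥ −(1−ε)(n/2) ln n`" (here: `b > 0` fixed, the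
bound holding for all large `n`).  Proof: by (7a) and the lower half of Lemma 2 the generalized Li
derivative is then `≥ (ε/2) n ln n − O(n) ≥ 0` for large `n`, so `k_{n,−b} ≥ 0` eventually, hence
`k_{n,−b} ≥ −K` for all `n`, which gives RH by Bombieri–Lagarias' condition (c) /
[Sekatskii2014] Theorem 1 (tree: `riemannHypothesis_of_liSekatskiiSum_ge_neg_pow`).  The hypothesis
is of RH strength (see `sekatskii2015_prop1_converse`). [cite: Sekatskii2015FirstApplications, Proposition 1 (p. 18)] -/
theorem sekatskii2015_prop1 {b : ℝ} (hb : 0 < b) {ε : ℝ} (hε : 0 < ε)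
    (h : ∀ᶠ n : ℕ in atTop,
      -((1 - ε) * ((n : ℝ) / 2 * Real.log n)) ≤ liSekatskiiZetaDeriv (-b) (b + 1) n) :
    RiemannHypothesis := by
  -- the constant of the lower bound
  set ψr : ℝ := (Complex.digamma ((((b + 1) / 2 : ℝ)) : ℂ)).re with hψ
  set C₁ : ℝ := (2 * b + 1) / 2 * Real.log ((b + 3) / 2) + 2 with hC₁
  set K : ℝ := C₁ / (2 * b + 1) + |ψr| / 2 + |Real.log Real.pi| / 2 with hK
  have hq : 0 < 2 * b + 1 := by linarith
  -- eventually the generalized Li derivative is nonnegative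
  have hlog : ∀ᶠ n : ℕ in atTop, 2 * K / ε ≤ Real.log n :=
    (Real.tendsto_log_atTop.comp tendsto_natCast_atTop_atTop).eventually_ge_atTop _
  have hev : ∀ᶠ n : ℕ in atTop, 0 ≤ liSekatskiiSum (-b) n := by
    filter_upwards [h, hlog, eventually_ge_atTop 1] with n hn hlogn hn1
    have hn0 : (0 : ℝ) ≤ n := Nat.cast_nonneg n
    have h7a := sekatskii2015_eq7a hb hn1
    have hlo := Sekatskii2015ZetaPart.trivialZeroSum_lower hb.le hn1
    have hlo' : ((2 * b + 1) / 2 * n * Real.log n - C₁ * n) / (2 * b + 1) ≤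
        liSekatskiiTrivialZeroSum b n / (2 * b + 1) := div_le_div_of_nonneg_right hlo hq.le
    have e1 : ((2 * b + 1) / 2 * n * Real.log n - C₁ * n) / (2 * b + 1) =
        (n : ℝ) / 2 * Real.log n - C₁ / (2 * b + 1) * n := by field_simp
    rw [e1] at hlo'
    have hψb : -(|ψr| / 2 * n) ≤ (n : ℝ) / 2 * ψr := by
      have := neg_abs_le ψr; nlinarith
    have hπb : -(|Real.log Real.pi| / 2 * n) ≤ -((n : ℝ) / 2 * Real.log Real.pi) := by
      have := le_abs_self (Real.log Real.pi); nlinarith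
    have hb1 : 0 ≤ (n : ℝ) / (b + 1) := by positivity
    have hmain : ε / 2 * n * Real.log n - K * n ≤ liSekatskiiDeriv (-b) (b + 1) n := by
      rw [h7a, hK]
      nlinarith
    have hKn : K * n ≤ ε / 2 * n * Real.log n := by
      have h1 : 2 * K ≤ ε * Real.log n := by
        have := (div_le_iff₀ hε).1 hlogn; linarith
      nlinarith
    rw [liSekatskiiSum_neg_eq_deriv b hn1]
    exact mul_nonneg hq.le (by linarith)
  -- hence `k_{n,−b} ≥ −K'` for all `n`
  obtain ⟨N, hN⟩ := eventually_atTop.1 hev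
  set K' : ℝ := ∑ m ∈ Finset.range N, |liSekatskiiSum (-b) m| with hK'
  have hK'0 : 0 ≤ K' := Finset.sum_nonneg fun m _ ↦ abs_nonneg _
  refine riemannHypothesis_of_liSekatskiiSum_ge_neg_pow (a := -b) (by linarith) (K := K') (k := 0)
    fun n _ ↦ ?_
  rw [pow_zero, mul_one]
  rcases le_or_gt N n with hNn | hNn
  · linarith [hN n hNn]
  · have hmem : n ∈ Finset.range N := Finset.mem_range.2 hNn
    have h1 : |liSekatskiiSum (-b) n| ≤ K' :=
      Finset.single_le_sum (f := fun m ↦ |liSekatskiiSum (-b) m|) (fun m _ ↦ abs_nonneg _) hmem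
    linarith [neg_abs_le (liSekatskiiSum (-b) n)]

/-- **Eq. (21), weak form** — PROVED: on RH, for fixed `b > 0`, the ζ-part
`(1/(n−1)!) dⁿ/dzⁿ[(z+b)^{n−1} ln((z−1)ζ(z))]|_{z=b+1}` is `O(n)` ("almost perfect compensation of
all terms in eq. (7a)", p. 19: the two `½ n ln n` of the RH-asymptotic of `k_{n,−b}` (Theorem 6, tree:
`sekatskii2014b_thm4`) and of the trivial-zero sum cancel).  The printed (21) pins the linear term
down to a window; that refinement and the conjectured `o(n)` are not typed (module docstring).
[cite: Sekatskii2015FirstApplications, eq. (21) (p. 19)] -/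
theorem sekatskii2015_eq21_isBigO (hRH : RiemannHypothesis) {b : ℝ} (hb : 0 < b) :
    (fun n : ℕ ↦ liSekatskiiZetaDeriv (-b) (b + 1) n) =O[atTop] (fun n : ℕ ↦ (n : ℝ)) := by
  set q : ℝ := 2 * b + 1 with hqdef
  have hq : 0 < q := by rw [hqdef]; linarith
  set ψr : ℝ := (Complex.digamma ((((b + 1) / 2 : ℝ)) : ℂ)).re with hψ
  set C : ℝ := (Real.eulerMascheroniConstant - 1 - Real.log (2 * Real.pi / q)) / 2 - ψr / 2 -
    1 / (b + 1) + Real.log Real.pi / 2 with hC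
  have h1 : (fun n : ℕ ↦ q⁻¹ * (liSekatskiiSum (-b) n - liSekatskiiMain (-b) n)) =O[atTop]
      (fun n : ℕ ↦ (n : ℝ)) := ((sekatskii2014b_thm4 hRH (-b)).isBigO).const_mul_left _
  have h2 : (fun n : ℕ ↦ q⁻¹ * (liSekatskiiTrivialZeroSum b n - (2 * b + 1) / 2 * n * Real.log n))
      =O[atTop] (fun n : ℕ ↦ (n : ℝ)) := (sekatskii2015_lemma2_isBigO hb.le).const_mul_left _
  have h3 : (fun n : ℕ ↦ C * (n : ℝ)) =O[atTop] (fun n : ℕ ↦ (n : ℝ)) :=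
    isBigO_const_mul_self C _ _
  refine ((h1.sub h2).add h3).congr' ?_ EventuallyEq.rfl
  filter_upwards [eventually_ge_atTop 1] with n hn1
  have h7a := sekatskii2015_eq7a hb hn1
  have hk := liSekatskiiSum_neg_eq_deriv b hn1
  have habs : |1 - 2 * (-b)| = 2 * b + 1 := by
    rw [show (1 : ℝ) - 2 * (-b) = 2 * b + 1 by ring]; exact abs_of_pos (by linarith)
  have hmain : liSekatskiiMain (-b) n = (2 * b + 1) / 2 * n * Real.log n +
      (2 * b + 1) / 2 * (Real.eulerMascheroniConstant - 1 - Real.log (2 * Real.pi / (2 * b + 1))) * n := by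
    rw [liSekatskiiMain, habs]
  have hZ : liSekatskiiZetaDeriv (-b) (b + 1) n = liSekatskiiDeriv (-b) (b + 1) n -
      liSekatskiiTrivialZeroSum b n / (2 * b + 1) -
      n / 2 * (Complex.digamma ((((b + 1) / 2 : ℝ)) : ℂ)).re - n / (b + 1) +
      n / 2 * Real.log Real.pi := by linarith
  have hD : liSekatskiiDeriv (-b) (b + 1) n = liSekatskiiSum (-b) n / (2 * b + 1) := by
    rw [hk]; field_simp
  rw [hZ, hD, hmain, hC, hψ, hqdef]
  have hb1 : (b : ℝ) + 1 ≠ 0 := by linarith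
  have hq' : (2 : ℝ) * b + 1 ≠ 0 := by linarith
  field_simp
  ring

/-- **Converse of Proposition 1** (RH-CONDITIONAL): on RH, for fixed `b > 0` and every `ε < 1`, the
bound of Proposition 1 holds for all large `n` (from `sekatskii2015_eq21_isBigO`).
[cite: Sekatskii2015FirstApplications, Proposition 1 (p. 18) and eq. (21) (p. 19)] -/
theorem sekatskii2015_prop1_converse (hRH : RiemannHypothesis) {b : ℝ} (hb : 0 < b) {ε : ℝ}
    (hε : ε < 1) :
    ∀ᶠ n : ℕ in atTop, -((1 - ε) * ((n : ℝ) / 2 * Real.log n)) ≤ liSekatskiiZetaDeriv (-b) (b + 1) n := by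
  obtain ⟨c, hc⟩ := (sekatskii2015_eq21_isBigO hRH hb).bound
  have hlog : ∀ᶠ n : ℕ in atTop, 2 * |c| / (1 - ε) ≤ Real.log n :=
    (Real.tendsto_log_atTop.comp tendsto_natCast_atTop_atTop).eventually_ge_atTop _
  filter_upwards [hc, hlog] with n hcn hlogn
  have hn0 : (0 : ℝ) ≤ n := Nat.cast_nonneg n
  rw [Real.norm_eq_abs, Real.norm_of_nonneg hn0] at hcn
  have h1 : -(|c| * n) ≤ liSekatskiiZetaDeriv (-b) (b + 1) n := by
    have := neg_abs_le (liSekatskiiZetaDeriv (-b) (b + 1) n)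
    have : c * n ≤ |c| * n := mul_le_mul_of_nonneg_right (le_abs_self c) hn0
    linarith
  have h2 : |c| * n ≤ (1 - ε) * ((n : ℝ) / 2 * Real.log n) := by
    have h3 : 2 * |c| ≤ (1 - ε) * Real.log n := by
      have := (div_le_iff₀ (by linarith : 0 < 1 - ε)).1 hlogn; linarith
    nlinarith
  linarith

/-- **Proposition 1 as an RH-EQUIVALENT record** (packaging of `sekatskii2015_prop1` and its converse):
for fixed `b > 0`, RH ⟺ for some `ε > 0` the ζ-part is eventually `≥ −(1−ε)(n/2) ln n`.  An
equivalence; neither side is asserted. [cite: Sekatskii2015FirstApplications, Proposition 1 (p. 18) and eq. (21) (p. 19)] -/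
theorem riemannHypothesis_iff_zetaPart_lower {b : ℝ} (hb : 0 < b) :
    RiemannHypothesis ↔ ∃ ε : ℝ, 0 < ε ∧ ∀ᶠ n : ℕ in atTop,
      -((1 - ε) * ((n : ℝ) / 2 * Real.log n)) ≤ liSekatskiiZetaDeriv (-b) (b + 1) n :=
  ⟨fun hRH ↦ ⟨1 / 2, by norm_num, sekatskii2015_prop1_converse hRH hb (by norm_num)⟩,
    fun ⟨_, hε, h⟩ ↦ sekatskii2015_prop1 hb hε h⟩

end Literature.NumberTheory.LFunctions
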